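import Summits.RiemannHypothesis.RiemannHypothesis.Theorems.WeilFormatCTailEvenJ
import Summits.RiemannHypothesis.RiemannHypothesis.Theorems.WeilFormatCMeanSquareGram
import HarnessLib

/-!
# Format C, L-C3b (even sector): the order-`J` tail majorant with the MEAN-SQUARE bound for the mode function

Route context: Fourier–Galerkin / Schur-complement certificates of Weil positivity on a window ("format C";
cell memo `run/shared/lean/pub/rh-explicit/rh-explicit-weil-10/FORMATC-DESIGN.md` §9.9.3 (ii); supporting
stmt-RiemannHypothesis-0098; seat rh-explicit-weil-10; lead ruling R7-43 (2)).  This is `WeilFormatC.even_tailJ_majorant`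
with ONE change: in the `A`-family term the square of the mode function `F_m²` is not bounded by `C_A²` mode by mode but
summed against `P_A(m)²` with `WeilFormatC.sum_Ico_modeF_sq_mul_sq_le` (mean square `½Σ_kΛ_k²/k` of the prime sum plus
Abel-bounded oscillatory terms; resonance data `s₁, s₋, s₊`, value `0` = crude).  At `a = 1` this replaces `C_A² ≈ 17.2`
by `c̄ ≈ 1.53` and shortens the minimal exact-column range from `B₃ = 768` to `448 = 2B` (kit job j165179, block 224, `J = 4`;
block 192: `> 768` to `384 = 2B`).

* `even_tailJMS_majorant` — functional form (every truncation `N`);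
* `even_tailJMS_majorant_matrix` — the same as `xᵀU₂x` for the explicit matrix (the `hU₂` premise of
  `sum_range_mul_mul_nonneg_of_certificate_sum_split`).

Standard axioms; no definitions; no RH claim.
-/

set_option autoImplicit false
-- `Summit.RiemannHypothesis.RiemannHypothesis.…` is the layout-mandated namespace (summit = problem name).
set_option linter.dupNamespace false

noncomputable section

open Complex Finset Matrix
open scoped Real BigOperators ArithmeticFunction.vonMangoldt

namespace Summit.RiemannHypothesis.RiemannHypothesis.Theorems.WeilFormatC

open Literature.NumberTheory.LFunctions Literature.NumberTheory.LFunctions.Yoshida1992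
open Literature.Analysis.SpecialFunctions

variable {a : ℝ}

/-! ## A rescaling identity for the matrix form -/

section Scale

/-- `ΣΣ αα'(cZ) + Σ α²(cG + R) = c(ΣΣ αα'Z + Σ α²G) + Σ α²R`. -/
theorem sum_sum_mul_scale_add_eq {D : ℕ} (c : ℝ) (Z : Fin D → Fin D → ℝ) (G R α : Fin D → ℝ) :
    (∑ j, ∑ j', α j * α j' * (c * Z j j')) + ∑ j, α j ^ 2 * (c * G j + R j)
      = c * ((∑ j, ∑ j', α j * α j' * Z j j') + ∑ j, α j ^ 2 * G j) + ∑ j, α j ^ 2 * R j := by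
  simp only [mul_add, Finset.mul_sum, Finset.sum_add_distrib]
  have h1 : ∀ j j', α j * α j' * (c * Z j j') = c * (α j * α j' * Z j j') := fun j j' ↦ by ring
  have h2 : ∀ j, α j ^ 2 * (c * G j) = c * (α j ^ 2 * G j) := fun j ↦ by ring
  simp only [h1, h2]
  ring

end Scale

/-! ## The tail majorant (mean-square form) -/

section Tail

/-- **Even tail majorant at order `J`, mean-square form.**  See the module docstring. -/
theorem even_tailJMS_majorant (ha : 0 < a) {B B₃ : ℕ} (hB : 1 ≤ B) (hBB : 2 * B ≤ B₃) (hB₃ : 2 ≤ B₃) (J : ℕ)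
    (d : ℕ → ℝ) {d₀ : ℝ} (hd₀ : 0 < d₀) (hd : ∀ m, B₃ ≤ m → d₀ ≤ d m) {θ η : ℝ} (hθ : 0 < θ) (hη : 0 < η)
    (s₁ : ℕ → ℝ) (sm sp : ℕ → ℕ → ℝ)
    (hs₁ : ∀ k ∈ weilPrimeIndex a, IsPrimePow k → 0 ≤ s₁ k ∧ s₁ k ≤ |Real.sin (π * Real.log k / a / 2)|)
    (hsm : ∀ k ∈ weilPrimeIndex a, ∀ k' ∈ weilPrimeIndex a, IsPrimePow k → IsPrimePow k' → k ≠ k' →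
      0 ≤ sm k k' ∧ sm k k' ≤ |Real.sin ((π * Real.log k / a - π * Real.log k' / a) / 2)|)
    (hsp : ∀ k ∈ weilPrimeIndex a, ∀ k' ∈ weilPrimeIndex a, IsPrimePow k → IsPrimePow k' →
      0 ≤ sp k k' ∧ sp k k' ≤ |Real.sin ((π * Real.log k / a + π * Real.log k' / a) / 2)|)
    (N : ℕ) (x : Fin B → ℝ) :
    ∑ m ∈ Finset.Ico B₃ N, (∑ i : Fin B,
        (if (i : ℕ) = 0 then gramCoeff a 0 m else if m = 0 then gramCoeff a i 0
          else (gramCoeff a i m + gramCoeff a i (-(m : ℤ))) / 2) * x i) ^ 2 / d m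
      ≤ (1 + θ) * (1 + η) * (1 / (π ^ 2 * d₀))
          * (((π / 4 + a * (1 + weilArchDensity (2 * a)) / (π * B₃)) ^ 2
                + (∑ k ∈ weilPrimeIndex a, ((Λ k : ℝ) / Real.sqrt k) ^ 2) / 2
                + 2 * (a * (1 + weilArchDensity (2 * a)) / (π * B₃)) * (∑ k ∈ weilPrimeIndex a, (Λ k : ℝ) / Real.sqrt k)
                + ((π / 2) * (∑ k ∈ weilPrimeIndex a, if s₁ k = 0 then (Λ k : ℝ) / Real.sqrt k else 0)
                  + (∑ k ∈ weilPrimeIndex a, ∑ k' ∈ (weilPrimeIndex a).erase k,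
                      if sm k k' = 0 then (Λ k : ℝ) / Real.sqrt k * ((Λ k' : ℝ) / Real.sqrt k') else 0) / 2
                  + (∑ k ∈ weilPrimeIndex a, ∑ k' ∈ weilPrimeIndex a,
                      if sp k k' = 0 then (Λ k : ℝ) / Real.sqrt k * ((Λ k' : ℝ) / Real.sqrt k') else 0) / 2))
              * ((∑ j : Fin J, ∑ j' : Fin J,
                  (∑ i : Fin B, (-1 : ℝ) ^ (i : ℕ) * (i : ℝ) ^ (2 * (j : ℕ)) * x i)
                  * (∑ i : Fin B, (-1 : ℝ) ^ (i : ℕ) * (i : ℝ) ^ (2 * (j' : ℕ)) * x i)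
                  * ((1 / (((2 * (j : ℕ) + 1) + (2 * (j' : ℕ) + 1) - 1 : ℕ) * (((B₃ - 1 : ℕ) : ℝ)) ^ ((2 * (j : ℕ) + 1) + (2 * (j' : ℕ) + 1) - 1))
                      + 1 / (((2 * (j : ℕ) + 1) + (2 * (j' : ℕ) + 1) - 1 : ℕ) * (B₃ : ℝ) ^ ((2 * (j : ℕ) + 1) + (2 * (j' : ℕ) + 1) - 1))) / 2))
                + ∑ j : Fin J, (∑ i : Fin B, (-1 : ℝ) ^ (i : ℕ) * (i : ℝ) ^ (2 * (j : ℕ)) * x i) ^ 2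
                  * ∑ j' : Fin J,
                    ((1 / (((2 * (j : ℕ) + 1) + (2 * (j' : ℕ) + 1) - 1 : ℕ) * (((B₃ - 1 : ℕ) : ℝ)) ^ ((2 * (j : ℕ) + 1) + (2 * (j' : ℕ) + 1) - 1))
                      - 1 / (((2 * (j : ℕ) + 1) + (2 * (j' : ℕ) + 1) - 1 : ℕ) * (B₃ : ℝ) ^ ((2 * (j : ℕ) + 1) + (2 * (j' : ℕ) + 1) - 1))) / 2)
                    * (B : ℝ) ^ (2 * (j' : ℕ) + 1) / (B : ℝ) ^ (2 * (j : ℕ) + 1))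
            + ∑ j : Fin J, (∑ i : Fin B, (-1 : ℝ) ^ (i : ℕ) * (i : ℝ) ^ (2 * (j : ℕ)) * x i) ^ 2
                * ∑ j' : Fin J,
                  ((π / 2) * (∑ k ∈ weilPrimeIndex a, (Λ k : ℝ) / Real.sqrt k / s₁ k)
                    + (∑ k ∈ weilPrimeIndex a, ∑ k' ∈ (weilPrimeIndex a).erase k,
                        (Λ k : ℝ) / Real.sqrt k * ((Λ k' : ℝ) / Real.sqrt k') / sm k k') / 2
                    + (∑ k ∈ weilPrimeIndex a, ∑ k' ∈ weilPrimeIndex a,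
                        (Λ k : ℝ) / Real.sqrt k * ((Λ k' : ℝ) / Real.sqrt k') / sp k k') / 2)
                  / (B₃ : ℝ) ^ ((2 * (j : ℕ) + 1) + (2 * (j' : ℕ) + 1))
                  * (B : ℝ) ^ (2 * (j' : ℕ) + 1) / (B : ℝ) ^ (2 * (j : ℕ) + 1))
        + (1 + θ) * (1 + η⁻¹) * (1 / d₀)
          * ((∑ r : Fin J, ∑ r' : Fin J,
                (∑ i : Fin B, (-1 : ℝ) ^ (i : ℕ) *
                  (-((i : ℝ) ^ (2 * (r : ℕ) + 1)) * ((Complex.digamma (1 / 4 + ((freq a i : ℝ) : ℂ) / 2 * I)).im / 2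
                      + (∑ k ∈ weilPrimeIndex a, (Λ k : ℝ) / Real.sqrt k * Real.sin (freq a i * Real.log k))
                      - archExpSumSin a i) / π
                    + 4 / a * (Real.exp (a / 2) - Real.exp (-(a / 2))) ^ 2 * (-1 : ℝ) ^ (r : ℕ)
                      * (a ^ 2 / (4 * π ^ 2)) ^ ((r : ℕ) + 1) * (1 / (1 + 4 * freq a i ^ 2))) * x i)
                * (∑ i : Fin B, (-1 : ℝ) ^ (i : ℕ) *
                  (-((i : ℝ) ^ (2 * (r' : ℕ) + 1)) * ((Complex.digamma (1 / 4 + ((freq a i : ℝ) : ℂ) / 2 * I)).im / 2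
                      + (∑ k ∈ weilPrimeIndex a, (Λ k : ℝ) / Real.sqrt k * Real.sin (freq a i * Real.log k))
                      - archExpSumSin a i) / π
                    + 4 / a * (Real.exp (a / 2) - Real.exp (-(a / 2))) ^ 2 * (-1 : ℝ) ^ (r' : ℕ)
                      * (a ^ 2 / (4 * π ^ 2)) ^ ((r' : ℕ) + 1) * (1 / (1 + 4 * freq a i ^ 2))) * x i)
                * ((1 / (((2 * (r : ℕ) + 2) + (2 * (r' : ℕ) + 2) - 1 : ℕ) * (((B₃ - 1 : ℕ) : ℝ)) ^ ((2 * (r : ℕ) + 2) + (2 * (r' : ℕ) + 2) - 1))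
                    + 1 / (((2 * (r : ℕ) + 2) + (2 * (r' : ℕ) + 2) - 1 : ℕ) * (B₃ : ℝ) ^ ((2 * (r : ℕ) + 2) + (2 * (r' : ℕ) + 2) - 1))) / 2))
              + ∑ r : Fin J, (∑ i : Fin B, (-1 : ℝ) ^ (i : ℕ) *
                  (-((i : ℝ) ^ (2 * (r : ℕ) + 1)) * ((Complex.digamma (1 / 4 + ((freq a i : ℝ) : ℂ) / 2 * I)).im / 2
                      + (∑ k ∈ weilPrimeIndex a, (Λ k : ℝ) / Real.sqrt k * Real.sin (freq a i * Real.log k))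
                      - archExpSumSin a i) / π
                    + 4 / a * (Real.exp (a / 2) - Real.exp (-(a / 2))) ^ 2 * (-1 : ℝ) ^ (r : ℕ)
                      * (a ^ 2 / (4 * π ^ 2)) ^ ((r : ℕ) + 1) * (1 / (1 + 4 * freq a i ^ 2))) * x i) ^ 2
                * ∑ r' : Fin J,
                  ((1 / (((2 * (r : ℕ) + 2) + (2 * (r' : ℕ) + 2) - 1 : ℕ) * (((B₃ - 1 : ℕ) : ℝ)) ^ ((2 * (r : ℕ) + 2) + (2 * (r' : ℕ) + 2) - 1))
                    - 1 / (((2 * (r : ℕ) + 2) + (2 * (r' : ℕ) + 2) - 1 : ℕ) * (B₃ : ℝ) ^ ((2 * (r : ℕ) + 2) + (2 * (r' : ℕ) + 2) - 1))) / 2)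
                  * (B : ℝ) ^ (2 * (r' : ℕ) + 2) / (B : ℝ) ^ (2 * (r : ℕ) + 2))
        + (1 + θ⁻¹) * ((B : ℝ) / (d₀ * ((4 * J + 1 : ℕ) * (((B₃ - 1 : ℕ) : ℝ)) ^ (4 * J + 1))))
          * ∑ i : Fin B, ((2 * (π / 4 + (∑ k ∈ weilPrimeIndex a, (Λ k : ℝ) / Real.sqrt k)
                + a * (1 + weilArchDensity (2 * a)) / π) * (i : ℝ) ^ (2 * J) / π
              + 4 / a * (Real.exp (a / 2) - Real.exp (-(a / 2))) ^ 2 * (a ^ 2 / (4 * π ^ 2)) ^ (J + 1)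
                * (1 / (1 + 4 * freq a i ^ 2))) ^ 2 * x i ^ 2) := by
  -- abbreviations
  set T := Finset.Ico B₃ N with hT
  have hB₃1 : 1 ≤ B₃ := by omega
  have hB0 : (0 : ℝ) < B := by exact_mod_cast hB
  set Fmode : ℕ → ℝ := fun n ↦ (Complex.digamma (1 / 4 + ((freq a n : ℝ) : ℂ) / 2 * I)).im / 2
      + (∑ k ∈ weilPrimeIndex a, (Λ k : ℝ) / Real.sqrt k * Real.sin (freq a n * Real.log k)) - archExpSumSin a n
    with hFmode
  set kP : ℝ := 4 / a * (Real.exp (a / 2) - Real.exp (-(a / 2))) ^ 2 with hkP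
  set q : ℝ := a ^ 2 / (4 * π ^ 2) with hq
  set cfac : ℕ → ℝ := fun n ↦ 1 / (1 + 4 * freq a n ^ 2) with hcfac
  -- row functionals
  set vA : Fin J → Fin B → ℝ := fun j i ↦ (-1 : ℝ) ^ (i : ℕ) * (i : ℝ) ^ (2 * (j : ℕ)) with hvA
  set vB : Fin J → Fin B → ℝ := fun r i ↦ (-1 : ℝ) ^ (i : ℕ) *
      (-((i : ℝ) ^ (2 * (r : ℕ) + 1)) * Fmode i / π + kP * (-1 : ℝ) ^ (r : ℕ) * q ^ ((r : ℕ) + 1) * cfac i) with hvB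
  set αA : Fin J → ℝ := fun j ↦ ∑ i, vA j i * x i with hαA
  set αB : Fin J → ℝ := fun r ↦ ∑ i, vB r i * x i with hαB
  set ρ : Fin B → ℝ := fun i ↦ (2 * (π / 4 + (∑ k ∈ weilPrimeIndex a, (Λ k : ℝ) / Real.sqrt k)
        + a * (1 + weilArchDensity (2 * a)) / π) * (i : ℝ) ^ (2 * J) / π + kP * q ^ (J + 1) * cfac i) with hρ
  set bcol : ℕ → Fin B → ℝ := fun m i ↦
    (if (i : ℕ) = 0 then gramCoeff a 0 m else if m = 0 then gramCoeff a i 0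
      else (gramCoeff a i m + gramCoeff a i (-(m : ℤ))) / 2) with hbcol
  -- per-mode facts
  have hTm : ∀ m ∈ T, B₃ ≤ m := fun m hm ↦ (Finset.mem_Ico.mp hm).1
  have key : ∀ m ∈ T, (∑ i, bcol m i * x i) ^ 2 / d m
      ≤ (1 + θ) * (1 + η) * (1 / (π ^ 2 * d₀)) * (Fmode m ^ 2 * (∑ j, αA j / (m : ℝ) ^ (2 * (j : ℕ) + 1)) ^ 2)
        + (1 + θ) * (1 + η⁻¹) * (1 / d₀) * (∑ r, αB r / (m : ℝ) ^ (2 * (r : ℕ) + 2)) ^ 2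
        + (1 + θ⁻¹) * ((B : ℝ) / d₀) * (∑ i, ρ i ^ 2 * x i ^ 2) * (1 / ((m : ℝ) ^ (2 * J + 1)) ^ 2) := by
    intro m hm
    have hmB := hTm m hm
    have hm1 : 1 ≤ m := le_trans hB₃1 hmB
    have hm0 : (0 : ℝ) < m := by exact_mod_cast hm1
    have hdm : d₀ ≤ d m := hd m hmB
    have hdpos : 0 < d m := lt_of_lt_of_le hd₀ hdm
    -- decomposition of the column sum
    set R : ℝ := ∑ i, (bcol m i - (-1 : ℝ) ^ m *
        (Fmode m / π * ∑ j ∈ Finset.range J, ((-1 : ℝ) ^ (i : ℕ) * (i : ℝ) ^ (2 * j)) / (m : ℝ) ^ (2 * j + 1)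
          + ∑ r ∈ Finset.range J, ((-1 : ℝ) ^ (i : ℕ) *
              (-((i : ℝ) ^ (2 * r + 1)) * Fmode i / π + kP * (-1 : ℝ) ^ r * q ^ (r + 1) * cfac i)) / (m : ℝ) ^ (2 * r + 2)))
        * x i with hR
    have hsplit : ∑ i, bcol m i * x i = (-1 : ℝ) ^ m * (Fmode m / π * (∑ j, αA j / (m : ℝ) ^ (2 * (j : ℕ) + 1)) + (∑ r, αB r / (m : ℝ) ^ (2 * (r : ℕ) + 2))) + R := by
      have ePA : (∑ j, αA j / (m : ℝ) ^ (2 * (j : ℕ) + 1)) = ∑ i : Fin B, (∑ j ∈ Finset.range J, ((-1 : ℝ) ^ (i : ℕ) * (i : ℝ) ^ (2 * j)) / (m : ℝ) ^ (2 * j + 1)) * x i := by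
        simp only [hαA, hvA, Finset.sum_div]
        rw [Finset.sum_comm]
        refine Finset.sum_congr rfl fun i _ ↦ ?_
        rw [Finset.sum_mul, Finset.sum_range]
        refine Finset.sum_congr rfl fun j _ ↦ by ring
      have ePB : (∑ r, αB r / (m : ℝ) ^ (2 * (r : ℕ) + 2)) = ∑ i : Fin B, (∑ r ∈ Finset.range J, ((-1 : ℝ) ^ (i : ℕ) *
          (-((i : ℝ) ^ (2 * r + 1)) * Fmode i / π + kP * (-1 : ℝ) ^ r * q ^ (r + 1) * cfac i)) / (m : ℝ) ^ (2 * r + 2)) * x i := by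
        simp only [hαB, hvB, Finset.sum_div]
        rw [Finset.sum_comm]
        refine Finset.sum_congr rfl fun i _ ↦ ?_
        rw [Finset.sum_mul, Finset.sum_range]
        refine Finset.sum_congr rfl fun r _ ↦ by ring
      rw [ePA, ePB, hR, Finset.mul_sum, mul_add, Finset.mul_sum, Finset.mul_sum, ← Finset.sum_add_distrib,
        ← Finset.sum_add_distrib]
      refine Finset.sum_congr rfl fun i _ ↦ by ring
    have hRle : |R| ≤ ∑ i, ρ i / (m : ℝ) ^ (2 * J + 1) * |x i| := by
      refine (Finset.abs_sum_le_sum_abs _ _).trans (Finset.sum_le_sum fun i _ ↦ ?_)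
      rw [abs_mul]
      refine mul_le_mul_of_nonneg_right ?_ (abs_nonneg _)
      have him : 2 * (i : ℕ) ≤ m := by have := i.isLt; omega
      have h := abs_evenKernel_col_sub_families_le ha hm1 him J
      simp only [hbcol, hFmode, hkP, hq, hcfac, hρ]
      exact h
    have hRsq : R ^ 2 ≤ (B : ℝ) * (∑ i, ρ i ^ 2 * x i ^ 2) * (1 / ((m : ℝ) ^ (2 * J + 1)) ^ 2) := by
      have h := sq_sum_mul_le_card_mul (ι := Fin B)
        (fun i ↦ (bcol m i - (-1 : ℝ) ^ m *
          (Fmode m / π * ∑ j ∈ Finset.range J, ((-1 : ℝ) ^ (i : ℕ) * (i : ℝ) ^ (2 * j)) / (m : ℝ) ^ (2 * j + 1)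
            + ∑ r ∈ Finset.range J, ((-1 : ℝ) ^ (i : ℕ) *
                (-((i : ℝ) ^ (2 * r + 1)) * Fmode i / π + kP * (-1 : ℝ) ^ r * q ^ (r + 1) * cfac i)) / (m : ℝ) ^ (2 * r + 2))))
        (fun i ↦ ρ i / (m : ℝ) ^ (2 * J + 1)) x (fun i ↦ by
          have him : 2 * (i : ℕ) ≤ m := by have := i.isLt; omega
          have h := abs_evenKernel_col_sub_families_le ha hm1 him J
          simp only [hbcol, hFmode, hkP, hq, hcfac, hρ]
          exact h)
      simp only [Fintype.card_fin] at h
      refine h.trans (le_of_eq ?_)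
      rw [mul_assoc, Finset.sum_mul]
      congr 1
      refine Finset.sum_congr rfl fun i _ ↦ ?_
      rw [div_pow]
      ring
    -- the structured part (the square of the mode function is KEPT)
    have hmain : (Fmode m / π * (∑ j, αA j / (m : ℝ) ^ (2 * (j : ℕ) + 1)) + (∑ r, αB r / (m : ℝ) ^ (2 * (r : ℕ) + 2))) ^ 2
        ≤ (1 + η) * (1 / π ^ 2) * (Fmode m ^ 2 * (∑ j, αA j / (m : ℝ) ^ (2 * (j : ℕ) + 1)) ^ 2) + (1 + η⁻¹) * (∑ r, αB r / (m : ℝ) ^ (2 * (r : ℕ) + 2)) ^ 2 := by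
      have hpp := sq_add_le_peterPaul (p := Fmode m / π * (∑ j, αA j / (m : ℝ) ^ (2 * (j : ℕ) + 1))) (q := (∑ r, αB r / (m : ℝ) ^ (2 * (r : ℕ) + 2))) hη
      refine hpp.trans (le_of_eq ?_)
      rw [mul_pow, div_pow]
      ring
    -- assemble: square, Peter–Paul in θ, divide by d m ≥ d₀
    have hsq : (∑ i, bcol m i * x i) ^ 2
        ≤ (1 + θ) * ((1 + η) * (1 / π ^ 2) * (Fmode m ^ 2 * (∑ j, αA j / (m : ℝ) ^ (2 * (j : ℕ) + 1)) ^ 2) + (1 + η⁻¹) * (∑ r, αB r / (m : ℝ) ^ (2 * (r : ℕ) + 2)) ^ 2)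
          + (1 + θ⁻¹) * ((B : ℝ) * (∑ i, ρ i ^ 2 * x i ^ 2) * (1 / ((m : ℝ) ^ (2 * J + 1)) ^ 2)) := by
      rw [hsplit]
      have hpp := sq_add_le_peterPaul (p := (-1 : ℝ) ^ m * (Fmode m / π * (∑ j, αA j / (m : ℝ) ^ (2 * (j : ℕ) + 1)) + (∑ r, αB r / (m : ℝ) ^ (2 * (r : ℕ) + 2)))) (q := R) hθ
      have hsgn : ((-1 : ℝ) ^ m * (Fmode m / π * (∑ j, αA j / (m : ℝ) ^ (2 * (j : ℕ) + 1)) + (∑ r, αB r / (m : ℝ) ^ (2 * (r : ℕ) + 2)))) ^ 2 = (Fmode m / π * (∑ j, αA j / (m : ℝ) ^ (2 * (j : ℕ) + 1)) + (∑ r, αB r / (m : ℝ) ^ (2 * (r : ℕ) + 2))) ^ 2 := by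
        rw [mul_pow, ← pow_mul, Even.neg_one_pow (by exact ⟨m, by ring⟩), one_mul]
      rw [hsgn] at hpp
      have h1 : 0 ≤ 1 + θ := by positivity
      have h2 : 0 ≤ 1 + θ⁻¹ := by positivity
      exact hpp.trans (add_le_add (mul_le_mul_of_nonneg_left hmain h1) (mul_le_mul_of_nonneg_left hRsq h2))
    have hnn : 0 ≤ (1 + θ) * ((1 + η) * (1 / π ^ 2) * (Fmode m ^ 2 * (∑ j, αA j / (m : ℝ) ^ (2 * (j : ℕ) + 1)) ^ 2) + (1 + η⁻¹) * (∑ r, αB r / (m : ℝ) ^ (2 * (r : ℕ) + 2)) ^ 2)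
          + (1 + θ⁻¹) * ((B : ℝ) * (∑ i, ρ i ^ 2 * x i ^ 2) * (1 / ((m : ℝ) ^ (2 * J + 1)) ^ 2)) := by
      have : 0 ≤ ∑ i, ρ i ^ 2 * x i ^ 2 := Finset.sum_nonneg fun i _ ↦ by positivity
      positivity
    calc (∑ i, bcol m i * x i) ^ 2 / d m
        ≤ ((1 + θ) * ((1 + η) * (1 / π ^ 2) * (Fmode m ^ 2 * (∑ j, αA j / (m : ℝ) ^ (2 * (j : ℕ) + 1)) ^ 2) + (1 + η⁻¹) * (∑ r, αB r / (m : ℝ) ^ (2 * (r : ℕ) + 2)) ^ 2)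
          + (1 + θ⁻¹) * ((B : ℝ) * (∑ i, ρ i ^ 2 * x i ^ 2) * (1 / ((m : ℝ) ^ (2 * J + 1)) ^ 2))) / d m :=
          div_le_div_of_nonneg_right hsq hdpos.le
      _ ≤ ((1 + θ) * ((1 + η) * (1 / π ^ 2) * (Fmode m ^ 2 * (∑ j, αA j / (m : ℝ) ^ (2 * (j : ℕ) + 1)) ^ 2) + (1 + η⁻¹) * (∑ r, αB r / (m : ℝ) ^ (2 * (r : ℕ) + 2)) ^ 2)
          + (1 + θ⁻¹) * ((B : ℝ) * (∑ i, ρ i ^ 2 * x i ^ 2) * (1 / ((m : ℝ) ^ (2 * J + 1)) ^ 2))) / d₀ :=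
          div_le_div_of_nonneg_left hnn hd₀ hdm
      _ = _ := by
          field_simp
  -- sum over the tail and apply the Hankel bounds
  have hsumA := sum_Ico_modeF_sq_mul_sq_le ha hB₃ (D := J) (fun j ↦ 2 * (j : ℕ) + 1) (fun j ↦ by omega)
    (fun j ↦ (B : ℝ) ^ (2 * (j : ℕ) + 1)) (fun j ↦ by positivity) s₁ sm sp hs₁ hsm hsp N αA
  have hsumB := sum_Ico_sq_sum_div_pow_le (D := J) (fun r ↦ 2 * (r : ℕ) + 2) (fun r ↦ by omega) hB₃
    (fun r ↦ (B : ℝ) ^ (2 * (r : ℕ) + 2)) (fun r ↦ by positivity) N αB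
  have hsumR := sum_Ico_one_div_pow_two_mul_le (E := 2 * J + 1) (by omega) hB₃ N
  have h4J : 2 * (2 * J + 1) - 1 = 4 * J + 1 := by omega
  rw [h4J] at hsumR
  -- the three coefficient signs
  have hcA : 0 ≤ (1 + θ) * (1 + η) * (1 / (π ^ 2 * d₀)) := by positivity
  have hcB : 0 ≤ (1 + θ) * (1 + η⁻¹) * (1 / d₀) := by positivity
  have hcR : 0 ≤ (1 + θ⁻¹) * ((B : ℝ) / d₀) * (∑ i, ρ i ^ 2 * x i ^ 2) := by
    have : 0 ≤ ∑ i, ρ i ^ 2 * x i ^ 2 := Finset.sum_nonneg fun i _ ↦ by positivity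
    positivity
  have hR' : ∑ m ∈ T, 1 / ((m : ℝ) ^ (2 * J + 1)) ^ 2
      ≤ 1 / ((4 * J + 1 : ℕ) * (((B₃ - 1 : ℕ) : ℝ)) ^ (4 * J + 1)) := hsumR
  have step1 : ∑ m ∈ T, (∑ i, bcol m i * x i) ^ 2 / d m
      ≤ (1 + θ) * (1 + η) * (1 / (π ^ 2 * d₀)) * ∑ m ∈ T, (Fmode m ^ 2 * (∑ j, αA j / (m : ℝ) ^ (2 * (j : ℕ) + 1)) ^ 2)
          + (1 + θ) * (1 + η⁻¹) * (1 / d₀) * ∑ m ∈ T, (∑ r, αB r / (m : ℝ) ^ (2 * (r : ℕ) + 2)) ^ 2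
          + (1 + θ⁻¹) * ((B : ℝ) / d₀) * (∑ i, ρ i ^ 2 * x i ^ 2) * ∑ m ∈ T, (1 / ((m : ℝ) ^ (2 * J + 1)) ^ 2) := by
    refine (Finset.sum_le_sum key).trans (le_of_eq ?_)
    simp only [Finset.sum_add_distrib, ← Finset.mul_sum]
  have step2 := add_le_add (add_le_add (mul_le_mul_of_nonneg_left hsumA hcA) (mul_le_mul_of_nonneg_left hsumB hcB))
    (mul_le_mul_of_nonneg_left hR' hcR)
  refine (step1.trans step2).trans (le_of_eq ?_)
  simp only [hαA, hαB, hvA, hvB, hρ, hFmode, hkP, hq, hcfac]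
  ring

/-- **Even tail majorant at order `J`, mean-square form — matrix form** (`hU₂` of
`sum_range_mul_mul_nonneg_of_certificate_sum_split` for the even sector). -/
theorem even_tailJMS_majorant_matrix (ha : 0 < a) {B B₃ : ℕ} (hB : 1 ≤ B) (hBB : 2 * B ≤ B₃) (hB₃ : 2 ≤ B₃) (J : ℕ)
    (d : ℕ → ℝ) {d₀ : ℝ} (hd₀ : 0 < d₀) (hd : ∀ m, B₃ ≤ m → d₀ ≤ d m) {θ η : ℝ} (hθ : 0 < θ) (hη : 0 < η)
    (s₁ : ℕ → ℝ) (sm sp : ℕ → ℕ → ℝ)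
    (hs₁ : ∀ k ∈ weilPrimeIndex a, IsPrimePow k → 0 ≤ s₁ k ∧ s₁ k ≤ |Real.sin (π * Real.log k / a / 2)|)
    (hsm : ∀ k ∈ weilPrimeIndex a, ∀ k' ∈ weilPrimeIndex a, IsPrimePow k → IsPrimePow k' → k ≠ k' →
      0 ≤ sm k k' ∧ sm k k' ≤ |Real.sin ((π * Real.log k / a - π * Real.log k' / a) / 2)|)
    (hsp : ∀ k ∈ weilPrimeIndex a, ∀ k' ∈ weilPrimeIndex a, IsPrimePow k → IsPrimePow k' →
      0 ≤ sp k k' ∧ sp k k' ≤ |Real.sin ((π * Real.log k / a + π * Real.log k' / a) / 2)|)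
    (N : ℕ) (x : Fin B → ℝ) :
    ∑ m ∈ Finset.Ico B₃ N, (∑ i : Fin B,
        (if (i : ℕ) = 0 then gramCoeff a 0 m else if m = 0 then gramCoeff a i 0
          else (gramCoeff a i m + gramCoeff a i (-(m : ℤ))) / 2) * x i) ^ 2 / d m
      ≤ x ⬝ᵥ (Matrix.of fun i i' : Fin B ↦
          (1 + θ) * (1 + η) * (1 / (π ^ 2 * d₀))
            * (∑ j : Fin J, ∑ j' : Fin J, (((π / 4 + a * (1 + weilArchDensity (2 * a)) / (π * B₃)) ^ 2 + (∑ k ∈ weilPrimeIndex a, ((Λ k : ℝ) / Real.sqrt k) ^ 2) / 2 + 2 * (a * (1 + weilArchDensity (2 * a)) / (π * B₃)) * (∑ k ∈ weilPrimeIndex a, (Λ k : ℝ) / Real.sqrt k) + ((π / 2) * (∑ k ∈ weilPrimeIndex a, if s₁ k = 0 then (Λ k : ℝ) / Real.sqrt k else 0) + (∑ k ∈ weilPrimeIndex a, ∑ k' ∈ (weilPrimeIndex a).erase k, if sm k k' = 0 then (Λ k : ℝ) / Real.sqrt k * ((Λ k' : ℝ) / Real.sqrt k') else 0) / 2 + (∑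 k ∈ weilPrimeIndex a, ∑ k' ∈ weilPrimeIndex a, if sp k k' = 0 then (Λ k : ℝ) / Real.sqrt k * ((Λ k' : ℝ) / Real.sqrt k') else 0) / 2)) * ((1 / (((2 * (j : ℕ) + 1) + (2 * (j' : ℕ) + 1) - 1 : ℕ) * (((B₃ - 1 : ℕ) : ℝ)) ^ ((2 * (j : ℕ) + 1) + (2 * (j' : ℕ) + 1) - 1)) + 1 / (((2 * (j : ℕ) + 1) + (2 * (j' : ℕ) + 1) - 1 : ℕ) * (B₃ : ℝ) ^ ((2 * (j : ℕ) + 1) + (2 * (j' : ℕ) + 1) - 1))) / 2) + (if j = j' then ((π / 4 + a * (1 + weilArchDensity (2 * a)) / (π * B₃)) ^ 2 + (∑ k ∈ weilPrimeIndex a, ((Λ k : ℝ) / Real.sqrt k) ^ 2) / 2 + 2 * (a * (1 + weilArchDensity (2 * a)) / (π * B₃)) * (∑ k ∈ weilPrimeIndex a, (Λ k : ℝ) / Real.sqrt k) + ((π / 2) * (∑ k ∈ weilPrimeIndex a, if s₁ k = 0 then (Λ k : ℝ) / Real.sqrt k else 0) + (∑ k ∈ weilPrimeIndex a, ∑ k'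 ∈ (weilPrimeIndex a).erase k, if sm k k' = 0 then (Λ k : ℝ) / Real.sqrt k * ((Λ k' : ℝ) / Real.sqrt k') else 0) / 2 + (∑ k ∈ weilPrimeIndex a, ∑ k' ∈ weilPrimeIndex a, if sp k k' = 0 then (Λ k : ℝ) / Real.sqrt k * ((Λ k' : ℝ) / Real.sqrt k') else 0) / 2)) * (∑ j' : Fin J, ((1 / (((2 * (j : ℕ) + 1) + (2 * (j' : ℕ) + 1) - 1 : ℕ) * (((B₃ - 1 : ℕ) : ℝ)) ^ ((2 * (j : ℕ) + 1) + (2 * (j' : ℕ) + 1) - 1)) - 1 / (((2 * (j : ℕ) + 1) + (2 * (j' : ℕ) + 1) - 1 : ℕ) * (B₃ : ℝ) ^ ((2 * (j : ℕ) + 1) + (2 * (j' : ℕ) + 1) - 1))) / 2) * (B : ℝ) ^ (2 * (j' : ℕ) + 1) / (B : ℝ) ^ (2 * (j : ℕ) + 1)) + (∑ j' : Fin J, ((π / 2) * (∑ k ∈ weilPrimeIndex a, (Λ k : ℝ) / Real.sqrt k / s₁ k) + (∑ k ∈ weilPrimeIndex a, ∑ k' ∈ (weilPrimeIndex a).erase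 k, (Λ k : ℝ) / Real.sqrt k * ((Λ k' : ℝ) / Real.sqrt k') / sm k k') / 2 + (∑ k ∈ weilPrimeIndex a, ∑ k' ∈ weilPrimeIndex a, (Λ k : ℝ) / Real.sqrt k * ((Λ k' : ℝ) / Real.sqrt k') / sp k k') / 2) / (B₃ : ℝ) ^ ((2 * (j : ℕ) + 1) + (2 * (j' : ℕ) + 1)) * (B : ℝ) ^ (2 * (j' : ℕ) + 1) / (B : ℝ) ^ (2 * (j : ℕ) + 1)) else 0)) * ((-1 : ℝ) ^ (i : ℕ) * (i : ℝ) ^ (2 * (j : ℕ))) * ((-1 : ℝ) ^ (i' : ℕ) * (i' : ℝ) ^ (2 * (j' : ℕ))))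
          + (1 + θ) * (1 + η⁻¹) * (1 / d₀)
            * (∑ r : Fin J, ∑ r' : Fin J, (((1 / (((2 * (r : ℕ) + 2) + (2 * (r' : ℕ) + 2) - 1 : ℕ) * (((B₃ - 1 : ℕ) : ℝ)) ^ ((2 * (r : ℕ) + 2) + (2 * (r' : ℕ) + 2) - 1)) + 1 / (((2 * (r : ℕ) + 2) + (2 * (r' : ℕ) + 2) - 1 : ℕ) * (B₃ : ℝ) ^ ((2 * (r : ℕ) + 2) + (2 * (r' : ℕ) + 2) - 1))) / 2) + (if r = r' then (∑ r' : Fin J, ((1 / (((2 * (r : ℕ) + 2) + (2 * (r' : ℕ) + 2) - 1 : ℕ) * (((B₃ - 1 : ℕ) : ℝ)) ^ ((2 * (r : ℕ) + 2) + (2 * (r' : ℕ) + 2) - 1)) - 1 / (((2 * (r : ℕ) + 2) + (2 * (r' : ℕ) + 2) - 1 : ℕ) * (B₃ : ℝ) ^ ((2 * (r : ℕ) + 2) + (2 * (r' : ℕ) + 2) - 1))) / 2) * (B : ℝ) ^ (2 * (r' : ℕ) + 2) / (B : ℝ) ^ (2 * (r : ℕ) + 2)) else 0)) * ((-1 : ℝ)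 ^ (i : ℕ) * (-((i : ℝ) ^ (2 * (r : ℕ) + 1)) * ((Complex.digamma (1 / 4 + ((freq a i : ℝ) : ℂ) / 2 * I)).im / 2 + (∑ k ∈ weilPrimeIndex a, (Λ k : ℝ) / Real.sqrt k * Real.sin (freq a i * Real.log k)) - archExpSumSin a i) / π + 4 / a * (Real.exp (a / 2) - Real.exp (-(a / 2))) ^ 2 * (-1 : ℝ) ^ (r : ℕ) * (a ^ 2 / (4 * π ^ 2)) ^ ((r : ℕ) + 1) * (1 / (1 + 4 * freq a i ^ 2)))) * ((-1 : ℝ) ^ (i' : ℕ) * (-((i' : ℝ) ^ (2 * (r' : ℕ) + 1)) * ((Complex.digamma (1 / 4 + ((freq a i' : ℝ) : ℂ) / 2 * I)).im / 2 + (∑ k ∈ weilPrimeIndex a, (Λ k : ℝ) / Real.sqrt k * Real.sin (freq a i' * Real.log k)) - archExpSumSin a i') / π + 4 / a * (Real.exp (a / 2) - Real.exp (-(a / 2))) ^ 2 * (-1 : ℝ) ^ (r' : ℕ) * (a ^ 2 / (4 * π ^ 2)) ^ ((r' : ℕ) + 1) * (1 / (1 + 4 * freq a i' ^ 2)))))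
          + (if i = i' then (1 + θ⁻¹) * ((B : ℝ) / (d₀ * ((4 * J + 1 : ℕ) * (((B₃ - 1 : ℕ) : ℝ)) ^ (4 * J + 1)))) * (2 * (π / 4 + (∑ k ∈ weilPrimeIndex a, (Λ k : ℝ) / Real.sqrt k) + a * (1 + weilArchDensity (2 * a)) / π) * (i : ℝ) ^ (2 * J) / π + 4 / a * (Real.exp (a / 2) - Real.exp (-(a / 2))) ^ 2 * (a ^ 2 / (4 * π ^ 2)) ^ (J + 1) * (1 / (1 + 4 * freq a i ^ 2))) ^ 2 else 0)) *ᵥ x := by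
  refine (even_tailJMS_majorant ha hB hBB hB₃ J d hd₀ hd hθ hη s₁ sm sp hs₁ hsm hsp N x).trans (le_of_eq ?_)
  rw [dotProduct_mulVec_eq_sum_sum]
  simp only [Matrix.of_apply]
  rw [sum_sum_mul_add3_eq, sum_sum_mul_gram_eq, sum_sum_mul_gram_eq, sum_sum_add_ite_mul_eq, sum_sum_add_ite_mul_eq,
    sum_sum_mul_scale_add_eq]

end Tail

end Summit.RiemannHypothesis.RiemannHypothesis.Theorems.WeilFormatC

end
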